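import Summits.Ventures.CertifiedManyBodySolver.Upper.StripCellStructure
import HarnessLib

/-!
# Route `R2cOpenStripTangentLine` — optional add-on v2.3, part 1/2 (route pen sr-mbsolver-var-7 g24; filed by l1-eng-1 g28):
# the SPIN-RESOLVED CELL CHARGES `n↑, n↓` and their conservation by the strip's cell bond matrix (producer-free)

HONEST FRAMING: first certified bounds; not a superconductivity verdict; every number certified or labelled float.
NO NUMBER IS CLAIMED HERE (every theorem is producer-free structure).

The landed `Upper.cellCharge` / `stripCellBondMatrix_conservesCharge` (`Upper/StripCellStructure.lean`) track ONE integer label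
(the total cell charge). eng-1's verifier (`FORMAT-bdstrip-cell-v1.md`, step 4) checks positivity per `(q↑, q↓)` block: the strip
tensor, the dual `Z` and every Hubbard bond word conserve `n↑` and `n↓` SEPARATELY. This file supplies that structure:

* Part A — a site-charge FUNCTION `χ : Fin 4 → ℕ` in place of `siteCharge`: `cellFnCharge κ χ`, shift/conservation
  combinators (`siteFnShift_*`, `cellFnShift_*`, `conservesFn_*`; the proofs of `Upper/StripCellStructure.lean` verbatim
  with `siteCharge ↦ χ`);
* Part B — the spin-resolved instance `siteSpinCharge σ a = [σ ∈ siteOcc a]`, `cellSpinCharge κ σ`: `c_τ` lowers `n_σ` by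
  `[σ = τ]`, the intra-cell Hamiltonian conserves `n_σ` (`[H, N] = [H, S^z] = 0`, `N_σ = ½N ± S^z`, transported through
  `toSpin` and `superSite κ`), hence **`stripCellBondMatrix_conservesSpinCharge`**; and `cellCharge = cellSpinCharge 0 + cellSpinCharge 1`.

Part 2/2 (`Theorems/R2cStripCellSpinSectors.lean`) turns per-`(n↑,n↓)`-sector PSD blocks into the dense dual hypothesis and
packages the two-charge row-makers.

Sources: Essler–Frahm–Göhmann–Klümper–Korepin (2005) §12.3.4 [EsslerEtAl2005]; Lieb, PRL 62 (1989) 1201, Remark (2)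
[LiebPRL1989]; Tasaki (2020) §9.3 [Tasaki2020]; eng-1 `FORMAT-bdstrip-cell-v1.md` step 4.
-/

noncomputable section

open Matrix Finset
open scoped ComplexOrder BigOperators Kronecker

namespace Summit.Ventures.CertifiedManyBodySolver.Upper

open Literature.MathematicalPhysics.QuantumLattice
open Literature.MathematicalPhysics.QuantumLattice.JordanWigner
open Literature.LinearAlgebra.Matrix.PolarOrthonormalization
open Summit.Ventures.CertifiedManyBodySolver.Theorems

variable {c W Q : ℕ}

/-! ### Part A — a general site-charge function `χ` -/

section FnCharge

/-- The cell charge of the configuration behind the super-site state `S` for a one-site charge function `χ`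
(`χ = siteCharge` gives `Upper.cellCharge`). -/
def cellFnCharge (κ : TensorIndex (Fin c ×ₗ Fin W) 4 ≃ Fin Q) (χ : Fin 4 → ℕ) (S : Fin Q) : ℕ :=
  ∑ f, χ ((κ.symm S) f)

/-- A diagonal one-site matrix shifts any site charge function by `0`. [folklore] -/
theorem siteFnShift_diagonal (χ : Fin 4 → ℕ) (d : Fin 4 → ℂ) :
    ∀ a b : Fin 4, diagonal d a b ≠ 0 → (χ a : ℤ) = χ b + 0 := by
  intro a b h
  by_cases hab : a = b
  · subst hab
    simp
  · exact absurd (diagonal_apply_ne d hab) h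

/-- The identity one-site matrix shifts any site charge function by `0`. [folklore] -/
theorem siteFnShift_one (χ : Fin 4 → ℕ) :
    ∀ a b : Fin 4, (1 : Matrix (Fin 4) (Fin 4) ℂ) a b ≠ 0 → (χ a : ℤ) = χ b + 0 := by
  rw [← diagonal_one]
  exact siteFnShift_diagonal χ _

/-- The site parity `F` shifts any site charge function by `0`. [folklore] -/
theorem siteFnShift_siteParity (χ : Fin 4 → ℕ) :
    ∀ a b : Fin 4, siteParity a b ≠ 0 → (χ a : ℤ) = χ b + 0 :=
  siteFnShift_diagonal χ _

/-- A string factor (`F` or `1`) shifts any site charge function by `0`. [folklore] -/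
theorem siteFnShift_of_eq_siteParity_or_one (χ : Fin 4 → ℕ) {N : Matrix (Fin 4) (Fin 4) ℂ}
    (h : N = siteParity ∨ N = 1) : ∀ a b : Fin 4, N a b ≠ 0 → (χ a : ℤ) = χ b + 0 := by
  rcases h with h | h <;> rw [h]
  · exact siteFnShift_siteParity χ
  · exact siteFnShift_one χ

/-- The conjugate transpose of a one-site matrix of `χ`-shift `δ` has `χ`-shift `-δ`. [folklore] -/
theorem siteFnShift_conjTranspose (χ : Fin 4 → ℕ) {M : Matrix (Fin 4) (Fin 4) ℂ} {δ : ℤ}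
    (hM : ∀ a b : Fin 4, M a b ≠ 0 → (χ a : ℤ) = χ b + δ) :
    ∀ a b : Fin 4, Mᴴ a b ≠ 0 → (χ a : ℤ) = χ b + (-δ) := by
  intro a b h
  rw [conjTranspose_apply] at h
  have := hM b a fun e => h (by rw [e, star_zero])
  omega

/-- `χ`-shifts add under multiplication of one-site matrices. [folklore] -/
theorem siteFnShift_mul (χ : Fin 4 → ℕ) {M N : Matrix (Fin 4) (Fin 4) ℂ} {δ δ' : ℤ}
    (hM : ∀ a b : Fin 4, M a b ≠ 0 → (χ a : ℤ) = χ b + δ)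
    (hN : ∀ a b : Fin 4, N a b ≠ 0 → (χ a : ℤ) = χ b + δ') :
    ∀ a b : Fin 4, (M * N) a b ≠ 0 → (χ a : ℤ) = χ b + (δ + δ') := by
  intro a b h
  rw [Matrix.mul_apply] at h
  obtain ⟨m, -, hm⟩ := Finset.exists_ne_zero_of_sum_ne_zero h
  have h1 := hM a m (left_ne_zero_of_mul hm)
  have h2 := hN m b (right_ne_zero_of_mul hm)
  omega

/-- A word that shifts `χ` by `δ` at one site `f₀` and by `0` elsewhere shifts the total `χ`-charge of a
configuration by `δ`. [folklore] -/
theorem sum_siteFn_eq_of_productOp_apply_ne_zero (χ : Fin 4 → ℕ) {F : Type*} [Fintype F] [DecidableEq F]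
    (g : F → Matrix (Fin 4) (Fin 4) ℂ) (f₀ : F) {δ : ℤ}
    (h0 : ∀ a b : Fin 4, g f₀ a b ≠ 0 → (χ a : ℤ) = χ b + δ)
    (hg : ∀ f, f ≠ f₀ → ∀ a b : Fin 4, g f a b ≠ 0 → (χ a : ℤ) = χ b + 0)
    (σ τ : F → Fin 4) (h : productOp g σ τ ≠ 0) :
    (∑ f, (χ (σ f) : ℤ)) = (∑ f, (χ (τ f) : ℤ)) + δ := by
  rw [productOp_apply] at h
  have hf : ∀ f, g f (σ f) (τ f) ≠ 0 := fun f => Finset.prod_ne_zero_iff.1 h f (Finset.mem_univ f)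
  have key : ∀ f, (χ (σ f) : ℤ) = χ (τ f) + if f = f₀ then δ else 0 := by
    intro f
    by_cases hff : f = f₀
    · rw [if_pos hff, hff]
      exact h0 _ _ (hf f₀)
    · rw [if_neg hff]
      exact hg f hff _ _ (hf f)
  rw [Finset.sum_congr rfl fun f _ => key f, Finset.sum_add_distrib,
    Finset.sum_ite_eq' Finset.univ f₀, if_pos (Finset.mem_univ _)]

/-- The `χ`-cell charge as an integer sum. -/
theorem cellFnCharge_cast (κ : TensorIndex (Fin c ×ₗ Fin W) 4 ≃ Fin Q) (χ : Fin 4 → ℕ) (S : Fin Q) :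
    (cellFnCharge κ χ S : ℤ) = ∑ f, (χ ((κ.symm S) f) : ℤ) := by
  simp [cellFnCharge]

/-- Blocking a word: the `χ`-cell-charge shift of `superSite κ (⨂ g)` is the shift of its one active site. [folklore] -/
theorem cellFnShift_superSite_productOp (κ : TensorIndex (Fin c ×ₗ Fin W) 4 ≃ Fin Q) (χ : Fin 4 → ℕ)
    (g : (Fin c ×ₗ Fin W) → Matrix (Fin 4) (Fin 4) ℂ) (f₀ : Fin c ×ₗ Fin W) {δ : ℤ}
    (h0 : ∀ a b : Fin 4, g f₀ a b ≠ 0 → (χ a : ℤ) = χ b + δ)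
    (hg : ∀ f, f ≠ f₀ → ∀ a b : Fin 4, g f a b ≠ 0 → (χ a : ℤ) = χ b + 0) :
    ∀ S S' : Fin Q, superSite κ (productOp g) S S' ≠ 0 →
      (cellFnCharge κ χ S : ℤ) = cellFnCharge κ χ S' + δ := by
  intro S S' h
  rw [superSite_apply] at h
  rw [cellFnCharge_cast, cellFnCharge_cast]
  exact sum_siteFn_eq_of_productOp_apply_ne_zero χ g f₀ h0 hg _ _ h

/-- The identity super-site matrix conserves every `χ`-cell charge. [folklore] -/
theorem cellFnShift_one (κ : TensorIndex (Fin c ×ₗ Fin W) 4 ≃ Fin Q) (χ : Fin 4 → ℕ) :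
    ∀ S S' : Fin Q, (1 : Matrix (Fin Q) (Fin Q) ℂ) S S' ≠ 0 →
      (cellFnCharge κ χ S : ℤ) = cellFnCharge κ χ S' + 0 := by
  intro S S' h
  by_cases hS : S = S'
  · subst hS
    simp
  · exact absurd (one_apply_ne hS) h

/-- Kronecker product of a left word shifting `χ` by `a` and a right word shifting by `b = −a` conserves the
two-cell `χ`-charge. [folklore] -/
theorem conservesFn_kronecker (κ : TensorIndex (Fin c ×ₗ Fin W) 4 ≃ Fin Q) (χ : Fin 4 → ℕ)
    {L R : Matrix (Fin Q) (Fin Q) ℂ} {a b : ℤ}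
    (hL : ∀ S S' : Fin Q, L S S' ≠ 0 → (cellFnCharge κ χ S : ℤ) = cellFnCharge κ χ S' + a)
    (hR : ∀ S S' : Fin Q, R S S' ≠ 0 → (cellFnCharge κ χ S : ℤ) = cellFnCharge κ χ S' + b) (hab : a + b = 0) :
    ∀ p p', (L ⊗ₖ R) p p' ≠ 0 →
      (cellFnCharge κ χ p.1 : ℤ) + cellFnCharge κ χ p.2 = cellFnCharge κ χ p'.1 + cellFnCharge κ χ p'.2 := by
  rintro ⟨S, T⟩ ⟨S', T'⟩ h
  rw [Matrix.kronecker_apply] at h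
  have h1 := hL S S' (left_ne_zero_of_mul h)
  have h2 := hR T T' (right_ne_zero_of_mul h)
  simp only
  omega

/-- `χ`-charge conservation of two-cell matrices is stable under addition. [folklore] -/
theorem conservesFn_add (κ : TensorIndex (Fin c ×ₗ Fin W) 4 ≃ Fin Q) (χ : Fin 4 → ℕ)
    {X Y : Matrix (Fin Q × Fin Q) (Fin Q × Fin Q) ℂ}
    (hX : ∀ p p', X p p' ≠ 0 →
      (cellFnCharge κ χ p.1 : ℤ) + cellFnCharge κ χ p.2 = cellFnCharge κ χ p'.1 + cellFnCharge κ χ p'.2)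
    (hY : ∀ p p', Y p p' ≠ 0 →
      (cellFnCharge κ χ p.1 : ℤ) + cellFnCharge κ χ p.2 = cellFnCharge κ χ p'.1 + cellFnCharge κ χ p'.2) :
    ∀ p p', (X + Y) p p' ≠ 0 →
      (cellFnCharge κ χ p.1 : ℤ) + cellFnCharge κ χ p.2 = cellFnCharge κ χ p'.1 + cellFnCharge κ χ p'.2 := by
  intro p p' h
  rw [Matrix.add_apply] at h
  by_cases hx : X p p' = 0
  · rw [hx, zero_add] at h
    exact hY p p' h
  · exact hX p p' hx

/-- `χ`-charge conservation of two-cell matrices is stable under scalar multiplication. [folklore] -/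
theorem conservesFn_smul (κ : TensorIndex (Fin c ×ₗ Fin W) 4 ≃ Fin Q) (χ : Fin 4 → ℕ)
    {X : Matrix (Fin Q × Fin Q) (Fin Q × Fin Q) ℂ}
    (hX : ∀ p p', X p p' ≠ 0 →
      (cellFnCharge κ χ p.1 : ℤ) + cellFnCharge κ χ p.2 = cellFnCharge κ χ p'.1 + cellFnCharge κ χ p'.2) (a : ℂ) :
    ∀ p p', (a • X) p p' ≠ 0 →
      (cellFnCharge κ χ p.1 : ℤ) + cellFnCharge κ χ p.2 = cellFnCharge κ χ p'.1 + cellFnCharge κ χ p'.2 := by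
  intro p p' h
  rw [Matrix.smul_apply, smul_eq_mul] at h
  exact hX p p' (right_ne_zero_of_mul h)

/-- `χ`-charge conservation of two-cell matrices is stable under finite sums. [folklore] -/
theorem conservesFn_sum (κ : TensorIndex (Fin c ×ₗ Fin W) 4 ≃ Fin Q) (χ : Fin 4 → ℕ) {ι : Type*} (s : Finset ι)
    {X : ι → Matrix (Fin Q × Fin Q) (Fin Q × Fin Q) ℂ}
    (hX : ∀ i ∈ s, ∀ p p', X i p p' ≠ 0 →
      (cellFnCharge κ χ p.1 : ℤ) + cellFnCharge κ χ p.2 = cellFnCharge κ χ p'.1 + cellFnCharge κ χ p'.2) :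
    ∀ p p', (∑ i ∈ s, X i) p p' ≠ 0 →
      (cellFnCharge κ χ p.1 : ℤ) + cellFnCharge κ χ p.2 = cellFnCharge κ χ p'.1 + cellFnCharge κ χ p'.2 := by
  intro p p' h
  rw [Matrix.sum_apply] at h
  obtain ⟨i, hi, hne⟩ := Finset.exists_ne_zero_of_sum_ne_zero h
  exact hX i hi p p' hne

end FnCharge

/-! ### Part B — the spin-resolved site charge -/

section SpinCharge

/-- The spin-resolved site occupation `[σ ∈ siteOcc a]` (`n_↑ = (0,1,0,1)`, `n_↓ = (0,0,1,1)` along the local basis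
`|0⟩, |↑⟩, |↓⟩, |↑↓⟩`; the diagonal of `siteNumber σ`). [cite: EsslerEtAl2005, §12.3.4 eq. (12.196)] -/
def siteSpinCharge (σ : Fin 2) (a : Fin 4) : ℕ :=
  if σ ∈ siteOcc a then 1 else 0

/-- The spin-resolved cell charge `n_σ` of the configuration behind the super-site state `S`. -/
def cellSpinCharge (κ : TensorIndex (Fin c ×ₗ Fin W) 4 ≃ Fin Q) (σ : Fin 2) (S : Fin Q) : ℕ :=
  cellFnCharge κ (siteSpinCharge σ) S

/-- `siteCharge = n_↑ + n_↓` site by site. [cite: EsslerEtAl2005, §12.3.4 eq. (12.196)] -/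
theorem siteCharge_eq_siteSpinCharge_add (a : Fin 4) :
    siteCharge a = siteSpinCharge 0 a + siteSpinCharge 1 a := by
  fin_cases a <;> rfl

/-- `cellCharge = cellSpinCharge 0 + cellSpinCharge 1`. -/
theorem cellCharge_eq_cellSpinCharge_add (κ : TensorIndex (Fin c ×ₗ Fin W) 4 ≃ Fin Q) (S : Fin Q) :
    cellCharge κ S = cellSpinCharge κ 0 S + cellSpinCharge κ 1 S := by
  unfold cellCharge cellSpinCharge cellFnCharge
  rw [← Finset.sum_add_distrib]
  exact Finset.sum_congr rfl fun f _ => siteCharge_eq_siteSpinCharge_add _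

/-- `c_τ` lowers `n_σ` by `[σ = τ]`. [cite: EsslerEtAl2005, §12.3.4 eq. (12.197)] -/
theorem siteSpinShift_siteAnnihilation (σ τ : Fin 2) :
    ∀ a b : Fin 4, siteAnnihilation τ a b ≠ 0 →
      (siteSpinCharge σ a : ℤ) = siteSpinCharge σ b + -(if σ = τ then (1 : ℤ) else 0) := by
  intro a b h
  rw [siteAnnihilation_apply] at h
  by_cases hc : τ ∉ siteOcc a ∧ siteOcc b = insert τ (siteOcc a)
  · obtain ⟨h1, h2⟩ := hc
    unfold siteSpinCharge
    simp only [h2, Finset.mem_insert]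
    by_cases hσ : σ = τ
    · subst hσ
      simp [h1]
    · by_cases hm : σ ∈ siteOcc a
      · simp [hσ, hm]
      · simp [hσ, hm]
  · rw [if_neg hc] at h
    exact absurd rfl h

/-- `c†_τ` raises `n_σ` by `[σ = τ]`. [cite: EsslerEtAl2005, §12.3.4 eq. (12.197)] -/
theorem siteSpinShift_siteCreation (σ τ : Fin 2) :
    ∀ a b : Fin 4, siteCreation τ a b ≠ 0 →
      (siteSpinCharge σ a : ℤ) = siteSpinCharge σ b + (if σ = τ then (1 : ℤ) else 0) := by
  have h := siteFnShift_conjTranspose (siteSpinCharge σ) (siteSpinShift_siteAnnihilation σ τ)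
  rw [neg_neg] at h
  exact h

/-- `superSite κ (Σ_f (n_σ)_f) = diag(cellSpinCharge κ σ)`. [folklore] -/
theorem superSite_sum_onSite_siteNumber (κ : TensorIndex (Fin c ×ₗ Fin W) 4 ≃ Fin Q) (σ : Fin 2) :
    superSite κ (∑ f : Fin c ×ₗ Fin W, onSite f (siteNumber σ)) =
      diagonal fun S => (((cellSpinCharge κ σ S : ℕ) : ℤ) : ℂ) := by
  ext S S'
  rw [superSite_apply, Matrix.sum_apply, diagonal_apply]
  simp only [siteNumber, onSite_diagonal, diagonal_apply, EmbeddingLike.apply_eq_iff_eq]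
  split_ifs with h
  · subst h
    simp [cellSpinCharge, cellFnCharge, siteSpinCharge]
  · simp

/-- The open-cluster `t–t'` Hamiltonian conserves `S^z`. [cite: LiebPRL1989, Remark (2)] -/
theorem hubbardOpenBoxTT'_commute_spinZ (a b : ℕ) (t t' U : ℝ) :
    Commute (hubbardOpenBoxTT' a b t t' U) HubbardWave0.spinZ :=
  ((hamiltonian_isHermitian_and_commute_holds (rectBoxGraph a b) t U).2.2).add_left
    ((hamiltonian_isHermitian_and_commute_holds (rectBoxDiagGraph a b) t' 0).2.2)

/-- The open-cluster `t–t'` Hamiltonian conserves `N_σ = Σ_y n_{yσ} = ½N ± S^z`. [cite: Tasaki2020, §9.3.1] -/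
theorem hubbardOpenBoxTT'_commute_sum_numberOp (a b : ℕ) (t t' U : ℝ) (σ : Fin 2) :
    Commute (hubbardOpenBoxTT' a b t t' U) (∑ y : Fin a ×ₗ Fin b, numberOp y σ) := by
  rw [sum_numberOp_eq_half_totalNumber_add_spinZ]
  exact ((hubbardOpenBoxTT'_commute_totalNumber a b t t' U).smul_right _).add_right
    ((hubbardOpenBoxTT'_commute_spinZ a b t t' U).smul_right _)

/-- `N_σ ↦ Σ_x (n_σ)_x` under Jordan–Wigner. [cite: EsslerEtAl2005, §12.3.4 eq. (12.196)] -/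
theorem toSpin_sum_numberOp {Λ : Type*} [LinearOrder Λ] [Fintype Λ] (σ : Fin 2) :
    toSpin (∑ y : Λ, numberOp y σ) = ∑ y : Λ, onSite y (siteNumber σ) := by
  rw [map_sum]
  exact Finset.sum_congr rfl fun y _ => toSpin_numberOp y σ

/-- **The intra-cell Hamiltonian conserves the spin-resolved cell charge** (`[H, N_σ] = 0`, transported through
`toSpin` and the blocking `superSite κ`). [cite: LiebPRL1989, Remark (2)] -/
theorem cellSpinShift_superSite_toSpin_hubbardOpenBoxTT' (κ : TensorIndex (Fin c ×ₗ Fin W) 4 ≃ Fin Q)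
    (t t' U : ℝ) (σ : Fin 2) :
    ∀ S S' : Fin Q, superSite κ (JordanWigner.toSpin (hubbardOpenBoxTT' c W t t' U)) S S' ≠ 0 →
      (cellSpinCharge κ σ S : ℤ) = cellSpinCharge κ σ S' + 0 := by
  have h := ((hubbardOpenBoxTT'_commute_sum_numberOp c W t t' U σ).map
    (JordanWigner.toSpin (Λ := Fin c ×ₗ Fin W))).map (superSite κ)
  rw [toSpin_sum_numberOp, superSite_sum_onSite_siteNumber κ] at h
  intro S S' hM
  rw [add_zero]
  by_contra hne
  exact hM (apply_eq_zero_of_commute_labelOp (fun S => (cellSpinCharge κ σ S : ℤ)) h.symm hne)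

/-- **The inter-cell coupling conserves the spin-resolved cell charge**: each word moves one `τ`-fermion across
the cut. [cite: EsslerEtAl2005, §12.3.4] -/
theorem interCellMatrix_conservesSpinCharge (κ : TensorIndex (Fin c ×ₗ Fin W) 4 ≃ Fin Q) (hc : 0 < c)
    (t : ℝ) (σ : Fin 2) :
    ∀ p p', interCellMatrix κ hc t p p' ≠ 0 →
      (cellSpinCharge κ σ p.1 : ℤ) + cellSpinCharge κ σ p.2 =
        cellSpinCharge κ σ p'.1 + cellSpinCharge κ σ p'.2 := by
  unfold interCellMatrix cellSpinCharge
  refine conservesFn_smul κ _ (conservesFn_sum κ _ _ fun y₀ _ =>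
    conservesFn_sum κ _ _ fun τ _ => ?_) _
  refine conservesFn_add κ _ ?_ ?_
  · refine conservesFn_kronecker κ _ (a := (if σ = τ then (1 : ℤ) else 0) + 0)
      (b := -(if σ = τ then (1 : ℤ) else 0))
      (cellFnShift_superSite_productOp κ _ _ (toLex (⟨c - 1, by omega⟩, y₀))
        (by rw [interLeftFamily_self]
            exact siteFnShift_mul _ (siteSpinShift_siteCreation σ τ) (siteFnShift_siteParity _))
        fun f hf => siteFnShift_of_eq_siteParity_or_one _ (interLeftFamily_of_ne hc y₀ _ hf))
      (cellFnShift_superSite_productOp κ _ _ (toLex (⟨0, hc⟩, y₀))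
        (by rw [interRightFamily_self]; exact siteSpinShift_siteAnnihilation σ τ)
        fun f hf => siteFnShift_of_eq_siteParity_or_one _ (interRightFamily_of_ne hc y₀ _ hf)) (by ring)
  · refine conservesFn_kronecker κ _ (a := 0 + -(if σ = τ then (1 : ℤ) else 0))
      (b := (if σ = τ then (1 : ℤ) else 0))
      (cellFnShift_superSite_productOp κ _ _ (toLex (⟨c - 1, by omega⟩, y₀))
        (by rw [interLeftFamily_self]
            exact siteFnShift_mul _ (siteFnShift_siteParity _) (siteSpinShift_siteAnnihilation σ τ))
        fun f hf => siteFnShift_of_eq_siteParity_or_one _ (interLeftFamily_of_ne hc y₀ _ hf))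
      (cellFnShift_superSite_productOp κ _ _ (toLex (⟨0, hc⟩, y₀))
        (by rw [interRightFamily_self]; exact siteSpinShift_siteCreation σ τ)
        fun f hf => siteFnShift_of_eq_siteParity_or_one _ (interRightFamily_of_ne hc y₀ _ hf)) (by ring)

/-- **The strip's cell bond matrix conserves the spin-resolved cell charge** (`σ = ↑, ↓` separately).
[cite: LiebPRL1989, Remark (2)] -/
theorem stripCellBondMatrix_conservesSpinCharge (κ : TensorIndex (Fin c ×ₗ Fin W) 4 ≃ Fin Q) (hc : 0 < c)
    (t U : ℝ) (σ : Fin 2) :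
    ∀ p p', stripCellBondMatrix κ hc t U p p' ≠ 0 →
      (cellSpinCharge κ σ p.1 : ℤ) + cellSpinCharge κ σ p.2 =
        cellSpinCharge κ σ p'.1 + cellSpinCharge κ σ p'.2 := by
  unfold stripCellBondMatrix
  have h1 := cellSpinShift_superSite_toSpin_hubbardOpenBoxTT' κ t 0 U σ
  have h2 := cellFnShift_one κ (siteSpinCharge σ)
  have h3 := interCellMatrix_conservesSpinCharge κ hc t σ
  unfold cellSpinCharge at h1 h3 ⊢
  exact conservesFn_add κ _ (conservesFn_kronecker κ _ h1 h2 (by norm_num)) h3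

end SpinCharge

/-- By-value sanity: along the local basis `|0⟩, |↑⟩, |↓⟩, |↑↓⟩`, `n_↑ = (0,1,0,1)` and `n_↓ = (0,0,1,1)`. -/
example : (siteSpinCharge 0 0, siteSpinCharge 0 1, siteSpinCharge 0 2, siteSpinCharge 0 3) = (0, 1, 0, 1) ∧
    (siteSpinCharge 1 0, siteSpinCharge 1 1, siteSpinCharge 1 2, siteSpinCharge 1 3) = (0, 0, 1, 1) := by
  decide

end Summit.Ventures.CertifiedManyBodySolver.Upper

end
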